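import Summits.BirchSwinnertonDyer.BirchSwinnertonDyer.Theorems.SemiOrdinaryEisensteinDescentWildSigmaDivisibilityAtThreeMultiCarrierOfMiddleExact
import Summits.BirchSwinnertonDyer.BirchSwinnertonDyer.Theorems.AdditiveKolyvaginRoadManinFrameFromDatum
import Summits.BirchSwinnertonDyer.Rank1Residual.ManinConstantOneEdges
import Literature.NumberTheory.EllipticCurves.ManinConstantConductorLt500000
import Literature.NumberTheory.EllipticCurves.NonEisensteinPrimeOfSurjective
import HarnessLib

/-!
# Crux J‴ `WildSigmaDivisibilityAtThreeMultiCarrier` (stmt-BirchSwinnertonDyer-25898), line `birth`: the MANIN stub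
# `stub_maninGood` IS Manin's conjecture for the class BY NAME — kernel link to the tree's Manin-constant layer
# (`ClassAbsManinConstantEqOne`, the conjecture leaf `ManinConstantOne`, Cremona's range `N ≤ 500000`)
# (route `SemiOrdinaryEisensteinDescent`; width seat `bsd-wall-soed-p2-w2` g7; `--supports stmt-BirchSwinnertonDyer-25898`, helper)

WHY. The registered skeleton `Cruxes/WildSigmaDivisibilityAtThreeMultiCarrier/Lines/birth.lean` (223b1f81) closes J‴ BY NAME from three
stubs: `stub_flatMultiCarrier` (RESEARCH: Büyükboduk 2009 §4.2 Q1 at the additive prime `3`), `stub_maninGood` (RESEARCH: «for every datum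
`Dt` of a curve of the cell the `3`-primitive part of its constant is ADMISSIBLE» — an ad-hoc text) and `stub_printConj` (PRINT). This
file identifies the second stub with the tree's OWN Manin-constant vocabulary (typing layer `Literature/…/ManinConstantClassCertificate`,
conjecture leaf `Summits/…/Rank1Residual/ManinConstantOne`): per curve, `stub_maninGood`'s conclusion follows from «`p ∤ c₀` for the
lattice-optimal `X₀(N)`-datum of the class AT THE CONDUCTOR LEVEL», hence from `ClassAbsManinConstantEqOne W`, hence from the
conjecture leaf `ManinConstantOne`, and — on Cremona's range `N ≤ 500000`, which contains every census class of the row — from the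
named PRINT fact `cremona_abs_maninConstant_eq_one_of_level_le_500000` with NO modularity fact (the given datum's newform supplies the
optimal curve: `exists_optimal_modularParametrizationData_of_isNewformOf`).

WHAT IS PROVED (theorems only; no definition, no named fact, no `sorry`; every curve-statement is CONDITIONAL on displayed hypotheses):
* §1 (route-independent, EVERY prime `p`) `exists_modularParametrizationData_not_dvd_of_optimal_not_dvd` — a globally minimal `W/ℚ`
  with a datum `Dt` at its conductor level `N`, `E[p]` irreducible, and `p ∤ c(D₀)` for every lattice-optimal datum `D₀` at level `N` of
  a globally minimal `W₀ ∼ W` ⟹ a datum `D` of `W` at level `N` with `D.f = Dt.f`, `D.L = Dt.L`, `p ∤ D.c`. Road = route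
  AdditiveKolyvaginRoad's `ManinFrameFromDatum.exists_modularParametrizationData_not_dvd_of_istarClass` (p-akr) with the Mazur–Stevens
  step replaced by the displayed hypothesis: optimal `W₀ ∼ W` with its minimal-degree datum (Pasten–Shimura §10.1 per curve, Edixhoven's
  integrality PROVED), lattice-optimality (`exists_optimalDatum'` + `latticeEq_of_modularDegree_le`), a prime-to-`p` integral multiplier
  `k Λ_{W₀} ⊆ Λ_W` (`X11b.exists_int_mul_mem_lattice_not_dvd`: the Néron mapping property `integral_neronScaling_of_isGloballyMinimal_holds`
  PROVED + irreducibility), the datum `(f, Λ_W, k·c₀)` (`ModularParametrizationData.exists_of_isNewformOf`). Corollaries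
  `…_of_classAbsManinConstantEqOne`, `…_of_level_le_500000` (Cremona, NO modularity fact), `…_of_maninConstantOne`.
* §2 (the cell's currencies at `p = 3`) `maninGood_of_classManin` — w3 g2's `hGood` («one `3`-good datum per curve of the cell») ⟸
  (∀ cell `W`, `ClassAbsManinConstantEqOne W`); `primitiveAdmissible_of_classManin` — `stub_maninGood`'s text VERBATIM ⟸ the same;
  `primitiveAdmissible_of_maninConstantOne` — `stub_maninGood` ⟸ the conjecture leaf `ManinConstantOne`; and the PER-CURVE discharge on
  Cremona's range `primitiveAdmissible_of_level_le_500000` (PRINT: `cremona_abs_maninConstant_eq_one_of_level_le_500000`).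
* §3 J‴ BY NAME: `wildSigmaDivisibilityAtThreeMultiCarrier_of_flatMultiCarrier_of_classManin_of_threePrintFacts` (⟸ PT_conj + E0 + 3.7(2)
  + `stub_flatMultiCarrier` + ∀ cell `W`, `ClassAbsManinConstantEqOne W`), `…_of_maninConstantOne_…` (Manin input = the conjecture leaf),
  `…_of_middleExact` (duality input = w2 g6's `hE`, Milne I 4.10(b) for THE maps), and the depth-window normal form
  `…_of_flatBeyondMax_of_classManin_…` (J⁗♭ ⊕ class-Manin ⊕ print).
NET for the line: `stub_maninGood` = Manin's conjecture (`3`-part, for the class) BY NAME — PRINT on `N ≤ 500000` (every census class of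
row 2·3@3), conjecture-leaf `ManinConstantOne` beyond; the line's research content off Cremona's range is `stub_flatMultiCarrier` ⊕
`ManinConstantOne|₃`, on it `stub_flatMultiCarrier` alone. HONEST FRAMING: nothing here proves a case of Manin's conjecture, of J‴, or of
BSD; `ClassAbsManinConstantEqOne`, `ManinConstantOne`, the Cremona sentence and the three print facts are HYPOTHESES / named facts.

References: [AgasheRibetStein2006] §§1–2, Thm. 2.6–2.7; [EdixhovenManin1991] §1, Prop. 2; [Cremona2022ManinConstants]; [CesnaviciusNeururerSaha2023]
§1 p. 574; [PastenShimura2024] §10.1; [SilvermanATAEC1994] IV.5–6, IV.9; [Jetchev2008] Thm. 1.4, Conj. 1.3; [MilneADT2006] I 4.10(b). BSD is not proved.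
-/

set_option autoImplicit false
set_option linter.dupNamespace false -- `Summit.BirchSwinnertonDyer.BirchSwinnertonDyer.…` is the tree's layout (D-0017)

noncomputable section

open scoped Classical

namespace Summit.BirchSwinnertonDyer.BirchSwinnertonDyer.Theorems.WildSigmaDivisibilityAtThreeMultiCarrierManinOfClassCertificate

open WeierstrassCurve NumberField IsDedekindDomain Literature.NumberTheory.EllipticCurves
  Literature.NumberTheory.EllipticCurves.ModularForms Literature.NumberTheory.Automorphic
  Literature.NumberTheory.GaloisRepresentations Literature.NumberTheory.GaloisCohomology
  Summit.BirchSwinnertonDyer.Rank1Residual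
  Summit.BirchSwinnertonDyer.Rank1Residual.Additive
  Summit.BirchSwinnertonDyer.Rank1Residual.X11b.Three
  Summit.BirchSwinnertonDyer.Rank1Residual.ManinConstant
  Summit.BirchSwinnertonDyer.BirchSwinnertonDyer.Theses.SemiOrdinaryEisensteinDescent
  Summit.BirchSwinnertonDyer.BirchSwinnertonDyer.Theorems.WildSigmaDivisibilityAtThreeMultiCarrierOfBeyondMaxOfManinGood
  Summit.BirchSwinnertonDyer.BirchSwinnertonDyer.Theorems.WildSigmaDivisibilityAtThreeMultiCarrierOfMiddleExact
  Summit.BirchSwinnertonDyer.BirchSwinnertonDyer.Theorems.WildKolyvaginUpperAtThreeTowerFreeManinPrimitive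
open Literature.NumberTheory.GaloisRepresentations.DiscreteGaloisModule (localTatePairingZMod unramifiedSubgroup)
open Literature.NumberTheory.EllipticCurves.GrossLMS1991 (prop37_2_frobeniusCongruence)

/-! ## §1 A `p`-good datum from the optimal curve of the class (route-independent, every prime `p`) -/

/-- **A datum of `W` with `p ∤ c` from «`p ∤ c₀` at the lattice-optimal `X₀(N)`-datum of the class».** Let `W/ℚ` be a globally
minimal elliptic curve with a parametrisation datum `Dt` at its conductor level `N`, `p` a prime with `E[p]` irreducible, and suppose
`p ∤ c(D₀)` for every datum `D₀` at level `N` of a globally minimal `W₀` `ℚ`-isogenous to `W` satisfying the lattice clause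
`Λ_{W₀} = c(D₀)·Λ_f` (the `X₀(N)`-optimal parametrisation). Then `W` has a datum `D` at level `N` with the same newform and Néron
lattice as `Dt` and `p ∤ D.c`: the optimal curve `W₀ ∼ W` with its minimal-degree datum `D₀` exists by the newform of `Dt` alone
(`exists_optimal_modularParametrizationData_of_isNewformOf`, Edixhoven's integrality PROVED), minimal degree forces the lattice clause
(`exists_optimalDatum'`, `latticeEq_of_modularDegree_le`), a cyclic `ℚ`-isogeny `W₀ → W` has degree prime to `p` (irreducibility) and
its Néron multiplier is integral (`integral_neronScaling_of_isGloballyMinimal_holds`), giving `k Λ_{W₀} ⊆ Λ_W` with `p ∤ k`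
(`X11b.exists_int_mul_mem_lattice_not_dvd`); the datum is `(f, Λ_W, k·c₀)` (`ModularParametrizationData.exists_of_isNewformOf`).
[cite: EdixhovenManin1991, §1 (typescript L96–101) and Prop. 2] [cite: PastenShimura2024, §10.1 (p. 33)]
[cite: SilvermanATAEC1994, IV.5.1 with IV.6.1 and Cor. IV.9.1] [cite: AgasheRibetStein2006, §§1–2] -/
theorem exists_modularParametrizationData_not_dvd_of_optimal_not_dvd
    {W : WeierstrassCurve ℚ} [W.IsElliptic] [W.IsGloballyMinimal] {N : ℕ} [NeZero N]
    (hN : W.conductorNorm ℤ = N) (Dt : ModularParametrizationData W N) {p : ℕ} (hp : p.Prime)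
    (hirr : W.HasIrreducibleModPGaloisRep p)
    (hopt_c : ∀ (W₀ : WeierstrassCurve ℚ) [W₀.IsElliptic] [W₀.IsGloballyMinimal]
      (D₀ : ModularParametrizationData W₀ N), W.IsIsogenous W₀ →
      (∀ z ∈ D₀.L.lattice, ∃ w ∈ periodLattice D₀.f, z = D₀.c * w) → ¬ (p : ℤ) ∣ D₀.c) :
    ∃ D : ModularParametrizationData W N, D.f = Dt.f ∧ D.L = Dt.L ∧ ¬ (p : ℤ) ∣ D.c := by
  haveI : (W.baseChange ℂ).IsElliptic := by rw [WeierstrassCurve.baseChange]; infer_instance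
  -- the optimal curve `W₀ ~ W` of the class, with its datum `D₀` of minimal degree (newform of `Dt`; no modularity fact)
  obtain ⟨W₀, hW₀, hW₀min, D₀, hfW, hisoW, hmin⟩ :=
    exists_optimal_modularParametrizationData_of_isNewformOf N W hN Dt.isNewformOf
  haveI := hW₀
  haveI := hW₀min
  -- minimal degree forces lattice-optimality `Λ_{W₀} = c₀ Λ_f`
  obtain ⟨W₁, hW₁, D₁, hf₁, h₁⟩ := D₀.exists_optimalDatum'
  haveI := hW₁
  have hopt : ∀ z ∈ D₀.L.lattice, ∃ w ∈ periodLattice D₀.f, z = D₀.c * w :=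
    D₀.latticeEq_of_modularDegree_le D₁ hf₁ h₁ (hmin W₁ D₁ hf₁)
  -- the displayed Manin hypothesis at the optimal member
  have hc₀ : ¬ (p : ℤ) ∣ D₀.c := hopt_c W₀ D₀ hisoW hopt
  -- an integral multiplier `k : Λ_{W₀} → Λ_W` prime to `p` (Néron mapping property, a theorem)
  obtain ⟨k, hk0, hpk, hk⟩ :=
    X11b.exists_int_mul_mem_lattice_not_dvd integral_neronScaling_of_isGloballyMinimal_holds
      hisoW.symm_of_charZero D₀.isNeronLattice Dt.isNeronLattice hp hirr
  -- the datum `(f, Λ_W, k c₀)` of `W`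
  have hm0 : k * D₀.c ≠ 0 := mul_ne_zero hk0 D₀.maninConstant_ne_zero_holds
  have hfD : D₀.f = Dt.f := hfW.unique Dt.isNewformOf
  have hle : ∀ z ∈ periodLattice Dt.f, ((k * D₀.c : ℤ) : ℂ) * z ∈ Dt.L.lattice := fun z hz ↦ by
    have h2 := hk _ (D₀.smul_periodLattice_le z (hfD ▸ hz))
    rwa [← mul_assoc, ← Int.cast_mul] at h2
  obtain ⟨D, hDf, hDL, hDc⟩ :=
    ModularParametrizationData.exists_of_isNewformOf Dt.isNewformOf Dt.isNeronLattice hm0 hle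
  refine ⟨D, hDf, hDL, fun hdvd ↦ ?_⟩
  rw [hDc] at hdvd
  rcases (Nat.prime_iff_prime_int.mp hp).dvd_or_dvd hdvd with h | h
  · exact hpk h
  · exact hc₀ h

/-- **A `p`-good datum from the class predicate `ClassAbsManinConstantEqOne W`** («the optimal curve of the isogeny class of `W` has
Manin constant `±1`», the class-local instance of Manin's conjecture, `ManinConstantClassCertificate`): for globally minimal `W` with a
datum at its conductor level and `E[p]` irreducible, some datum of `W` at that level has `p ∤ c` (§1 with
`ClassAbsManinConstantEqOne.not_dvd_maninConstant`). [cite: AgasheRibetStein2006, §2 and Thm. 2.6–2.7]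
[cite: EdixhovenManin1991, §1] -/
theorem exists_modularParametrizationData_not_dvd_of_classAbsManinConstantEqOne
    {W : WeierstrassCurve ℚ} [W.IsElliptic] [W.IsGloballyMinimal] {N : ℕ} [NeZero N]
    (hN : W.conductorNorm ℤ = N) (Dt : ModularParametrizationData W N) {p : ℕ} (hp : p.Prime)
    (hirr : W.HasIrreducibleModPGaloisRep p) (hMan : ClassAbsManinConstantEqOne W) :
    ∃ D : ModularParametrizationData W N, D.f = Dt.f ∧ D.L = Dt.L ∧ ¬ (p : ℤ) ∣ D.c :=
  exists_modularParametrizationData_not_dvd_of_optimal_not_dvd hN Dt hp hirr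
    fun _W₀ _ _ D₀ hiso hopt ↦ hMan.not_dvd_maninConstant D₀ hiso hopt hp

/-- **A `p`-good datum on Cremona's range, NO modularity fact**: for globally minimal `W` of conductor `N ≤ 500000` with a datum at
level `N` and `E[p]` irreducible, some datum at level `N` has `p ∤ c` — modulo the named PRINT fact
`cremona_abs_maninConstant_eq_one_of_level_le_500000` (Cremona: the Manin constant of every optimal curve of conductor `≤ 500000` is
`1`, as cited in Česnavičius–Neururer–Saha §1), applied to the optimal datum AT LEVEL `N` that §1 produces from the given datum's
newform. [cite: CesnaviciusNeururerSaha2023, §1 p. 574 and ref. [Cre22]] [cite: Cremona2022ManinConstants, ¶ "Concerning the Manin constant"] -/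
theorem exists_modularParametrizationData_not_dvd_of_level_le_500000
    (h500 : cremona_abs_maninConstant_eq_one_of_level_le_500000)
    {W : WeierstrassCurve ℚ} [W.IsElliptic] [W.IsGloballyMinimal] {N : ℕ} [NeZero N]
    (hN : W.conductorNorm ℤ = N) (hN500 : N ≤ 500000) (Dt : ModularParametrizationData W N) {p : ℕ}
    (hp : p.Prime) (hirr : W.HasIrreducibleModPGaloisRep p) :
    ∃ D : ModularParametrizationData W N, D.f = Dt.f ∧ D.L = Dt.L ∧ ¬ (p : ℤ) ∣ D.c :=
  exists_modularParametrizationData_not_dvd_of_optimal_not_dvd hN Dt hp hirr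
    fun W₀ _ _ D₀ _hiso hopt ↦ not_dvd_maninConstant_of_level_le_500000 h500 W₀ D₀ hopt hN500 hp

/-- **A `p`-good datum under the conjecture leaf `ManinConstantOne`** (Manin 1971 §10.3: `c = ±1` for every `X₀(N)`-optimal
parametrisation; registered `@[conjecture]`, nothing asserted): §1 with `classAbsManinConstantEqOne_of_maninConstantOne`.
[cite: AgasheRibetStein2006, Conjecture 2.1 (p. 619; shape only, nothing asserted)] -/
theorem exists_modularParametrizationData_not_dvd_of_maninConstantOne (hM : ManinConstantOne)
    {W : WeierstrassCurve ℚ} [W.IsElliptic] [W.IsGloballyMinimal] {N : ℕ} [NeZero N]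
    (hN : W.conductorNorm ℤ = N) (Dt : ModularParametrizationData W N) {p : ℕ} (hp : p.Prime)
    (hirr : W.HasIrreducibleModPGaloisRep p) :
    ∃ D : ModularParametrizationData W N, D.f = Dt.f ∧ D.L = Dt.L ∧ ¬ (p : ℤ) ∣ D.c :=
  exists_modularParametrizationData_not_dvd_of_classAbsManinConstantEqOne hN Dt hp hirr
    (classAbsManinConstantEqOne_of_maninConstantOne hM W)

/-! ## §2 The cell's Manin currencies at `p = 3`: `hGood` and `stub_maninGood` from the class predicate / the leaf / Cremona -/

/-- **w3 g2's `hGood` («one `3`-good datum per curve of the cell») ⟸ `ClassAbsManinConstantEqOne` on the cell.** On the onto wild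
cell `E[3]` is irreducible (`hasIrreducibleModPGaloisRep_of_hasSurjectiveModNGaloisRep`), so §1 applies at `p = 3`.
[cite: AgasheRibetStein2006, §2 and Thm. 2.7] [cite: EdixhovenManin1991, §1] -/
theorem maninGood_of_classManin
    (hMan : ∀ (W : WeierstrassCurve ℚ) [W.IsElliptic] [W.IsGloballyMinimal],
      ClassO6 W 3 → W.HasSurjectiveModNGaloisRep 3 → W.analyticRank = 1 → ClassAbsManinConstantEqOne W) :
    ∀ (W : WeierstrassCurve ℚ) [W.IsElliptic] [W.IsGloballyMinimal] (N : ℕ) [NeZero N],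
      ClassO6 W 3 → W.HasSurjectiveModNGaloisRep 3 → W.analyticRank = 1 → W.conductorNorm ℤ = N →
      Nonempty (ModularParametrizationData W N) →
      ∃ Dt₀ : ModularParametrizationData W N, ¬ (3 : ℤ) ∣ Dt₀.c := by
  intro W _ _ N _ hO6 hsurj hr hN hD
  obtain ⟨Dt⟩ := hD
  haveI : Fact (Nat.Prime 3) := ⟨Nat.prime_three⟩
  have hirr : W.HasIrreducibleModPGaloisRep 3 :=
    hasIrreducibleModPGaloisRep_of_hasSurjectiveModNGaloisRep W 3 (by exact_mod_cast hsurj)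
  obtain ⟨D, -, -, hD⟩ := exists_modularParametrizationData_not_dvd_of_classAbsManinConstantEqOne hN Dt
    Nat.prime_three hirr (hMan W hO6 hsurj hr)
  exact ⟨D, hD⟩

/-- **`stub_maninGood` of line `birth` VERBATIM ⟸ `ClassAbsManinConstantEqOne` on the cell**: the `3`-primitive part of every
datum's constant is admissible (`Dt.c = k·c₁`, `3 ∤ c₁`, `c₁ Λ_f ⊆ Λ_W`) — via w2 g5's `primitiveAdmissible_of_maninGood` (Bézout on
the admissible group; `IsNewformOf.unique`, `IsNeronLatticeOf.lattice_eq`). So the line's Manin stub is the class-local Manin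
predicate BY NAME. [cite: AgasheRibetStein2006, §2 and Thm. 2.7] [cite: EdixhovenManin1991, §1] -/
theorem primitiveAdmissible_of_classManin
    (hMan : ∀ (W : WeierstrassCurve ℚ) [W.IsElliptic] [W.IsGloballyMinimal],
      ClassO6 W 3 → W.HasSurjectiveModNGaloisRep 3 → W.analyticRank = 1 → ClassAbsManinConstantEqOne W) :
    ∀ (W : WeierstrassCurve ℚ) [W.IsElliptic] [W.IsGloballyMinimal] (N : ℕ) [NeZero N],
      ClassO6 W 3 → W.HasSurjectiveModNGaloisRep 3 → W.analyticRank = 1 → W.conductorNorm ℤ = N →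
      ∀ (Dt : ModularParametrizationData W N), ∃ (c₁ k : ℤ), Dt.c = k * c₁ ∧ ¬ (3 : ℤ) ∣ c₁ ∧
        ∀ z ∈ periodLattice Dt.f, (c₁ : ℂ) * z ∈ Dt.L.lattice :=
  primitiveAdmissible_of_maninGood (maninGood_of_classManin hMan)

/-- **`stub_maninGood` ⟸ the conjecture leaf `ManinConstantOne`** (registered `@[conjecture]`; Manin 1971 §10.3 for every class):
the line's Manin stub is a COROLLARY of the leaf (`classAbsManinConstantEqOne_of_maninConstantOne` ∘ the above).
[cite: AgasheRibetStein2006, Conjecture 2.1 (p. 619; shape only, nothing asserted)] -/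
theorem primitiveAdmissible_of_maninConstantOne (hM : ManinConstantOne) :
    ∀ (W : WeierstrassCurve ℚ) [W.IsElliptic] [W.IsGloballyMinimal] (N : ℕ) [NeZero N],
      ClassO6 W 3 → W.HasSurjectiveModNGaloisRep 3 → W.analyticRank = 1 → W.conductorNorm ℤ = N →
      ∀ (Dt : ModularParametrizationData W N), ∃ (c₁ k : ℤ), Dt.c = k * c₁ ∧ ¬ (3 : ℤ) ∣ c₁ ∧
        ∀ z ∈ periodLattice Dt.f, (c₁ : ℂ) * z ∈ Dt.L.lattice :=
  primitiveAdmissible_of_classManin fun W _ _ _ _ _ ↦ classAbsManinConstantEqOne_of_maninConstantOne hM W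

/-- **`hGood` under the leaf**: one `3`-good datum per curve of the cell ⟸ `ManinConstantOne`.
[cite: AgasheRibetStein2006, Conjecture 2.1 (p. 619; shape only, nothing asserted)] -/
theorem maninGood_of_maninConstantOne (hM : ManinConstantOne) :
    ∀ (W : WeierstrassCurve ℚ) [W.IsElliptic] [W.IsGloballyMinimal] (N : ℕ) [NeZero N],
      ClassO6 W 3 → W.HasSurjectiveModNGaloisRep 3 → W.analyticRank = 1 → W.conductorNorm ℤ = N →
      Nonempty (ModularParametrizationData W N) →
      ∃ Dt₀ : ModularParametrizationData W N, ¬ (3 : ℤ) ∣ Dt₀.c :=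
  maninGood_of_classManin fun W _ _ _ _ _ ↦ classAbsManinConstantEqOne_of_maninConstantOne hM W

/-- **`stub_maninGood` PER CURVE on Cremona's range `N ≤ 500000` — PRINT, no modularity fact, no Galois-image hypothesis beyond
irreducibility.** For globally minimal `W` of conductor `N ≤ 500000` with `E[3]` irreducible and every datum `Dt` at level `N`:
`Dt.c = k·c₁` with `3 ∤ c₁` admissible — from the named fact `cremona_abs_maninConstant_eq_one_of_level_le_500000` (§1) and Bézout as in
`primitiveAdmissible_of_maninGood`. Every census class of row 2·3@3 (conductor `< 500000`) is on this range.
[cite: CesnaviciusNeururerSaha2023, §1 p. 574 and ref. [Cre22]] [cite: Cremona2022ManinConstants, ¶ "Concerning the Manin constant"]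
[cite: EdixhovenManin1991, §1] -/
theorem primitiveAdmissible_of_level_le_500000 (h500 : cremona_abs_maninConstant_eq_one_of_level_le_500000)
    {W : WeierstrassCurve ℚ} [W.IsElliptic] [W.IsGloballyMinimal] {N : ℕ} [NeZero N]
    (hN : W.conductorNorm ℤ = N) (hN500 : N ≤ 500000) (hirr : W.HasIrreducibleModPGaloisRep 3)
    (Dt : ModularParametrizationData W N) :
    ∃ (c₁ k : ℤ), Dt.c = k * c₁ ∧ ¬ (3 : ℤ) ∣ c₁ ∧ ∀ z ∈ periodLattice Dt.f, (c₁ : ℂ) * z ∈ Dt.L.lattice := by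
  obtain ⟨Dt₀, hf, hL, h3⟩ :=
    exists_modularParametrizationData_not_dvd_of_level_le_500000 h500 hN hN500 Dt Nat.prime_three hirr
  refine ⟨(Int.gcd Dt.c Dt₀.c : ℤ), Dt.c / (Int.gcd Dt.c Dt₀.c : ℤ), ?_, ?_, ?_⟩
  · exact (Int.ediv_mul_cancel (Int.gcd_dvd_left Dt.c Dt₀.c)).symm
  · exact fun h ↦ h3 (h.trans (Int.gcd_dvd_right Dt.c Dt₀.c))
  · intro z hz
    have h1 : (Dt.c : ℂ) * z ∈ Dt.L.lattice := Dt.smul_periodLattice_le z hz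
    have h2 : (Dt₀.c : ℂ) * z ∈ Dt.L.lattice := hL ▸ Dt₀.smul_periodLattice_le z (hf ▸ hz)
    have hB : ((Int.gcd Dt.c Dt₀.c : ℤ) : ℂ) * z =
        (Dt.c.gcdA Dt₀.c : ℂ) * ((Dt.c : ℂ) * z) + (Dt.c.gcdB Dt₀.c : ℂ) * ((Dt₀.c : ℂ) * z) := by
      rw [Int.gcd_eq_gcd_ab Dt.c Dt₀.c]; push_cast; ring
    have hmul : ∀ (a : ℤ) {x : ℂ}, x ∈ Dt.L.lattice → (a : ℂ) * x ∈ Dt.L.lattice := fun a x hx ↦ by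
      rw [← zsmul_eq_mul]; exact Dt.L.lattice.smul_mem a hx
    rw [hB]
    exact Dt.L.lattice.add_mem (hmul _ h1) (hmul _ h2)

/-- The same on Cremona's range in the cell's `hGood` currency (onto wild cell: `E[3]` irreducible from `ρ̄₃` onto).
[cite: CesnaviciusNeururerSaha2023, §1 p. 574 and ref. [Cre22]] -/
theorem maninGood_of_level_le_500000 (h500 : cremona_abs_maninConstant_eq_one_of_level_le_500000)
    {W : WeierstrassCurve ℚ} [W.IsElliptic] [W.IsGloballyMinimal] {N : ℕ} [NeZero N]
    (hN : W.conductorNorm ℤ = N) (hN500 : N ≤ 500000) (hsurj : W.HasSurjectiveModNGaloisRep 3)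
    (Dt : ModularParametrizationData W N) :
    ∃ Dt₀ : ModularParametrizationData W N, ¬ (3 : ℤ) ∣ Dt₀.c := by
  haveI : Fact (Nat.Prime 3) := ⟨Nat.prime_three⟩
  have hirr : W.HasIrreducibleModPGaloisRep 3 :=
    hasIrreducibleModPGaloisRep_of_hasSurjectiveModNGaloisRep W 3 (by exact_mod_cast hsurj)
  obtain ⟨D, -, -, hD⟩ :=
    exists_modularParametrizationData_not_dvd_of_level_le_500000 h500 hN hN500 Dt Nat.prime_three hirr
  exact ⟨D, hD⟩

/-! ## §3 J‴ BY NAME with the Manin input = the class predicate / the conjecture leaf -/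

/-- **Crux of record J‴ `WildSigmaDivisibilityAtThreeMultiCarrier` (25898) BY NAME ⟸ (PT_conj), E0, 3.7 (2) + `stub_flatMultiCarrier`
(`hJmF`, RESEARCH: Büyükboduk 2009 §4.2 Q1 at the additive prime `3`) + `ClassAbsManinConstantEqOne` on the cell** — the skeleton's
composition with `stub_maninGood` discharged from the class-local Manin predicate (§2). CONDITIONAL on all five displayed hypotheses;
nothing asserted about any curve. [cite: Jetchev2008, Rem. 1.2, Thm. 1.4 and Conj. 1.3 (p. 812)] [cite: Buyukboduk2009TamagawaDefect, §4.2 Question 1]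
[cite: AgasheRibetStein2006, §2 and Thm. 2.7] -/
theorem wildSigmaDivisibilityAtThreeMultiCarrier_of_flatMultiCarrier_of_classManin_of_threePrintFacts
    (hPT : ∀ (K : Type) [Field K] [NumberField K], poitouTate_selmerStructure_duality_conj K)
    (hE0 : Gross1991_heegnerPoint_sub_ratTorsion_mem_E0) (h372 : prop37_2_frobeniusCongruence)
    (hMan : ∀ (W : WeierstrassCurve ℚ) [W.IsElliptic] [W.IsGloballyMinimal],
      ClassO6 W 3 → W.HasSurjectiveModNGaloisRep 3 → W.analyticRank = 1 → ClassAbsManinConstantEqOne W)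
    (hJmF : ∀ (W : WeierstrassCurve ℚ) [W.IsElliptic] [W.IsGloballyMinimal] (N : ℕ) [NeZero N] (K : Type)
      [Field K] [NumberField K] (Dt : ModularParametrizationData W N)
      (H : HeegnerDatum N (NumberField.discr K)) (ι : K →+* ℂ) (P : (W.baseChange K).toAffine.Point),
      ClassO6 W 3 → W.HasSurjectiveModNGaloisRep 3 → W.analyticRank = 1 → W.conductorNorm ℤ = N →
      IsImaginaryQuadratic K → SatisfiesHeegnerHypothesis N K →
      (W.quadraticTwist (NumberField.discr K : ℚ)).entireLFunction 1 ≠ 0 →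
      WeierstrassCurve.Affine.Point.map ι.toRatAlgHom P = heegnerPointComplex Dt H →
      ¬ IsOfFinAddOrder P → Odd (NumberField.discr K) → NumberField.discr K ≠ -3 →
      ¬ (3 : ℤ) ∣ Dt.c →
      (∀ (q : ℕ) [Fact q.Prime], q ∣ N →
        padicValNat 3 ((W.baseChange ℚ_[q]).localTamagawaNumber ℤ_[q]) <
          padicValNat 3 W.tamagawaProduct + padicValNat 3 Dt.c.natAbs) →
      ∀ (s' : ℕ), s' ≤ padicValNat 3 W.tamagawaProduct + padicValNat 3 Dt.c.natAbs →
        ∀ (n : ℕ) (d : KolyvaginHeegnerData Dt H.β ι n), Squarefree n →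
          (∀ ℓ ∈ n.primeFactors, Zhang2014.IsKolyvaginPrime N W K 3 ℓ ∧
            s' ≤ Zhang2014.kolyvaginIndex W 3 ℓ) → Koly.PDiv d 3 s') :
    WildSigmaDivisibilityAtThreeMultiCarrier :=
  wildSigmaDivisibilityAtThreeMultiCarrier_of_towerFree
    (wildSigmaDivisibilityAtThreeTowerFree_of_flatMultiCarrier_of_primitiveAdmissible_of_threePrintFacts hPT hE0 h372
      (primitiveAdmissible_of_classManin hMan) hJmF)

/-- **J‴ (25898) BY NAME ⟸ (PT_conj), E0, 3.7 (2) + `stub_flatMultiCarrier` + the conjecture leaf `ManinConstantOne`.** The line's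
Manin input is the registered Manin leaf by name; the only other research input is `stub_flatMultiCarrier`. CONDITIONAL; nothing
asserted. [cite: Jetchev2008, Thm. 1.4 and Conj. 1.3 (p. 812)] [cite: Buyukboduk2009TamagawaDefect, §4.2 Question 1]
[cite: AgasheRibetStein2006, Conjecture 2.1 (p. 619; shape only, nothing asserted)] -/
theorem wildSigmaDivisibilityAtThreeMultiCarrier_of_flatMultiCarrier_of_maninConstantOne_of_threePrintFacts
    (hPT : ∀ (K : Type) [Field K] [NumberField K], poitouTate_selmerStructure_duality_conj K)
    (hE0 : Gross1991_heegnerPoint_sub_ratTorsion_mem_E0) (h372 : prop37_2_frobeniusCongruence)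
    (hM : ManinConstantOne)
    (hJmF : ∀ (W : WeierstrassCurve ℚ) [W.IsElliptic] [W.IsGloballyMinimal] (N : ℕ) [NeZero N] (K : Type)
      [Field K] [NumberField K] (Dt : ModularParametrizationData W N)
      (H : HeegnerDatum N (NumberField.discr K)) (ι : K →+* ℂ) (P : (W.baseChange K).toAffine.Point),
      ClassO6 W 3 → W.HasSurjectiveModNGaloisRep 3 → W.analyticRank = 1 → W.conductorNorm ℤ = N →
      IsImaginaryQuadratic K → SatisfiesHeegnerHypothesis N K →
      (W.quadraticTwist (NumberField.discr K : ℚ)).entireLFunction 1 ≠ 0 →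
      WeierstrassCurve.Affine.Point.map ι.toRatAlgHom P = heegnerPointComplex Dt H →
      ¬ IsOfFinAddOrder P → Odd (NumberField.discr K) → NumberField.discr K ≠ -3 →
      ¬ (3 : ℤ) ∣ Dt.c →
      (∀ (q : ℕ) [Fact q.Prime], q ∣ N →
        padicValNat 3 ((W.baseChange ℚ_[q]).localTamagawaNumber ℤ_[q]) <
          padicValNat 3 W.tamagawaProduct + padicValNat 3 Dt.c.natAbs) →
      ∀ (s' : ℕ), s' ≤ padicValNat 3 W.tamagawaProduct + padicValNat 3 Dt.c.natAbs →
        ∀ (n : ℕ) (d : KolyvaginHeegnerData Dt H.β ι n), Squarefree n →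
          (∀ ℓ ∈ n.primeFactors, Zhang2014.IsKolyvaginPrime N W K 3 ℓ ∧
            s' ≤ Zhang2014.kolyvaginIndex W 3 ℓ) → Koly.PDiv d 3 s') :
    WildSigmaDivisibilityAtThreeMultiCarrier :=
  wildSigmaDivisibilityAtThreeMultiCarrier_of_flatMultiCarrier_of_classManin_of_threePrintFacts hPT hE0 h372
    (fun W _ _ _ _ _ ↦ classAbsManinConstantEqOne_of_maninConstantOne hM W) hJmF

/-- **J‴ (25898) BY NAME, depth-window normal form: ⟸ (PT_conj), E0, 3.7 (2) + J⁗♭ (`hFlatB`: `3^{s′} ∣ P(n)` only for the depths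
`max_q ord₃ c_q < s′ ≤ Σ_q ord₃ c_q`, data with `3 ∤ c`) + `ClassAbsManinConstantEqOne` on the cell** (w3 g2's p609057 normal form with
`hGood` from §2). CONDITIONAL; nothing asserted. [cite: Jetchev2008, Thm. 1.4 and Conj. 1.3 (p. 812)]
[cite: Buyukboduk2009TamagawaDefect, §4.2 Question 1] [cite: AgasheRibetStein2006, §2 and Thm. 2.7] -/
theorem wildSigmaDivisibilityAtThreeMultiCarrier_of_flatBeyondMax_of_classManin_of_threePrintFacts
    (hPT : ∀ (K : Type) [Field K] [NumberField K], poitouTate_selmerStructure_duality_conj K)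
    (hE0 : Gross1991_heegnerPoint_sub_ratTorsion_mem_E0) (h372 : prop37_2_frobeniusCongruence)
    (hFlatB : ∀ (W : WeierstrassCurve ℚ) [W.IsElliptic] [W.IsGloballyMinimal] (N : ℕ) [NeZero N] (K : Type)
      [Field K] [NumberField K] (Dt : ModularParametrizationData W N)
      (H : HeegnerDatum N (NumberField.discr K)) (ι : K →+* ℂ) (P : (W.baseChange K).toAffine.Point),
      ClassO6 W 3 → W.HasSurjectiveModNGaloisRep 3 → W.analyticRank = 1 → W.conductorNorm ℤ = N →
      IsImaginaryQuadratic K → SatisfiesHeegnerHypothesis N K →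
      (W.quadraticTwist (NumberField.discr K : ℚ)).entireLFunction 1 ≠ 0 →
      WeierstrassCurve.Affine.Point.map ι.toRatAlgHom P = heegnerPointComplex Dt H →
      ¬ IsOfFinAddOrder P → Odd (NumberField.discr K) → NumberField.discr K ≠ -3 →
      ¬ (3 : ℤ) ∣ Dt.c →
      ∀ (s' : ℕ), (∀ (q : ℕ) [Fact q.Prime], q ∣ N →
        padicValNat 3 ((W.baseChange ℚ_[q]).localTamagawaNumber ℤ_[q]) < s') →
      s' ≤ padicValNat 3 W.tamagawaProduct + padicValNat 3 Dt.c.natAbs →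
        ∀ (n : ℕ) (d : KolyvaginHeegnerData Dt H.β ι n), Squarefree n →
          (∀ ℓ ∈ n.primeFactors, Zhang2014.IsKolyvaginPrime N W K 3 ℓ ∧
            s' ≤ Zhang2014.kolyvaginIndex W 3 ℓ) → Koly.PDiv d 3 s')
    (hMan : ∀ (W : WeierstrassCurve ℚ) [W.IsElliptic] [W.IsGloballyMinimal],
      ClassO6 W 3 → W.HasSurjectiveModNGaloisRep 3 → W.analyticRank = 1 → ClassAbsManinConstantEqOne W) :
    WildSigmaDivisibilityAtThreeMultiCarrier :=
  wildSigmaDivisibilityAtThreeMultiCarrier_of_flatBeyondMax_of_maninGood_of_threePrintFacts hPT hE0 h372 hFlatB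
    (maninGood_of_classManin hMan)

/-- **J‴ (25898) BY NAME with the duality input = `hE`** (Milne I Thm. 4.10(b) `Ker γ¹ ⊆ Im β¹` for THE canonical maps, every `K`,
`n`; w2 g6's `…OfMiddleExact`) **+ E0 + 3.7 (2) + `stub_flatMultiCarrier` + `ClassAbsManinConstantEqOne` on the cell.** So the line's
inputs beyond the three printed statements are exactly `stub_flatMultiCarrier` (research) and the class-local Manin predicate (Manin's
conjecture for the class; PRINT on Cremona's range by §2). CONDITIONAL; nothing asserted. [cite: MilneADT2006, Ch. I, Thm. 4.10(b)]
[cite: Jetchev2008, Thm. 1.4 and Conj. 1.3 (p. 812)] [cite: Buyukboduk2009TamagawaDefect, §4.2 Question 1]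
[cite: AgasheRibetStein2006, §2 and Thm. 2.7] -/
theorem wildSigmaDivisibilityAtThreeMultiCarrier_of_flatMultiCarrier_of_classManin_of_middleExact
    (hE : ∀ (K : Type) [Field K] [NumberField K] (n : ℕ) [NeZero n],
      ∀ ⦃M : Type⦄ [AddCommGroup M] [TopologicalSpace M] [DiscreteTopology M] [Finite M]
      (ρ : DiscreteGaloisModule K M), (∀ m : M, n • m = 0) →
      ∀ S : Finset (Place K), (∀ w : InfinitePlace K, (Sum.inl w : Place K) ∈ S) →
        (∀ v : HeightOneSpectrum (𝓞 K), (Sum.inr v : Place K) ∉ S →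
          ((n : ℕ) : 𝓞 K) ∉ v.asIdeal ∧ GaloisRep.IsUnramifiedAt v ρ) →
        ∀ t : Π v : Place K, galoisCohomology (ρ.toLocal v) 1,
          (∀ y : galoisCohomology (ρ.tateDual n) 1,
            (∀ v : HeightOneSpectrum (𝓞 K), (Sum.inr v : Place K) ∉ S →
              galoisCohomology.localization (ρ.tateDual n) (Sum.inr v) 1 y ∈
                unramifiedSubgroup (GaloisRep.toLocal v (ρ.tateDual n)) 1) →
            ∑ v ∈ S, localTatePairingZMod ρ n v (LocalInvariants.canonical K n v) (t v)
              (galoisCohomology.localization (ρ.tateDual n) v 1 y) = 0) →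
          ∃ x : galoisCohomology ρ 1,
            (∀ v : HeightOneSpectrum (𝓞 K), (Sum.inr v : Place K) ∉ S →
              galoisCohomology.localization ρ (Sum.inr v) 1 x ∈
                unramifiedSubgroup (GaloisRep.toLocal v ρ) 1) ∧
            ∀ v ∈ S, galoisCohomology.localization ρ v 1 x = t v)
    (hE0 : Gross1991_heegnerPoint_sub_ratTorsion_mem_E0) (h372 : prop37_2_frobeniusCongruence)
    (hMan : ∀ (W : WeierstrassCurve ℚ) [W.IsElliptic] [W.IsGloballyMinimal],
      ClassO6 W 3 → W.HasSurjectiveModNGaloisRep 3 → W.analyticRank = 1 → ClassAbsManinConstantEqOne W)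
    (hJmF : ∀ (W : WeierstrassCurve ℚ) [W.IsElliptic] [W.IsGloballyMinimal] (N : ℕ) [NeZero N] (K : Type)
      [Field K] [NumberField K] (Dt : ModularParametrizationData W N)
      (H : HeegnerDatum N (NumberField.discr K)) (ι : K →+* ℂ) (P : (W.baseChange K).toAffine.Point),
      ClassO6 W 3 → W.HasSurjectiveModNGaloisRep 3 → W.analyticRank = 1 → W.conductorNorm ℤ = N →
      IsImaginaryQuadratic K → SatisfiesHeegnerHypothesis N K →
      (W.quadraticTwist (NumberField.discr K : ℚ)).entireLFunction 1 ≠ 0 →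
      WeierstrassCurve.Affine.Point.map ι.toRatAlgHom P = heegnerPointComplex Dt H →
      ¬ IsOfFinAddOrder P → Odd (NumberField.discr K) → NumberField.discr K ≠ -3 →
      ¬ (3 : ℤ) ∣ Dt.c →
      (∀ (q : ℕ) [Fact q.Prime], q ∣ N →
        padicValNat 3 ((W.baseChange ℚ_[q]).localTamagawaNumber ℤ_[q]) <
          padicValNat 3 W.tamagawaProduct + padicValNat 3 Dt.c.natAbs) →
      ∀ (s' : ℕ), s' ≤ padicValNat 3 W.tamagawaProduct + padicValNat 3 Dt.c.natAbs →
        ∀ (n : ℕ) (d : KolyvaginHeegnerData Dt H.β ι n), Squarefree n →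
          (∀ ℓ ∈ n.primeFactors, Zhang2014.IsKolyvaginPrime N W K 3 ℓ ∧
            s' ≤ Zhang2014.kolyvaginIndex W 3 ℓ) → Koly.PDiv d 3 s') :
    WildSigmaDivisibilityAtThreeMultiCarrier :=
  wildSigmaDivisibilityAtThreeMultiCarrier_of_lineStubs_of_middleExact hE hE0 h372
    (primitiveAdmissible_of_classManin hMan) hJmF

end Summit.BirchSwinnertonDyer.BirchSwinnertonDyer.Theorems.WildSigmaDivisibilityAtThreeMultiCarrierManinOfClassCertificate

end
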